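import Mathlib
import Summits.KontsevichZagierPeriods.Zeta5Search.Ray1Points
import Summits.KontsevichZagierPeriods.Zeta5Search.LevelClassDigits
import Summits.KontsevichZagierPeriods.Zeta5Search.SmallPrimeDominance
import HarnessLib

/-!
# ζ(5) search — T1-map ray C1 (`bRay β1 n`, `β = (85; 35,32,30,27,25,22,20)`): LAW-M WINDOW `36n < p ≤ 38n`, class bound `−3` BY NAME

Cell `pub-zeta5` (HONEST FRAMING: systematic search; no irrationality claim unless certified), prover seat P1,
generation 13.  `p`-adic valuations of explicit rational numbers; every exponent this feeds is `< 1` — NO irrationality content;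
nothing about `ζ(5)` is claimed.

Census g33's KERNEL LEDGER of the T1-map ray C1 = g8 #1 (`a = (18,32,23,30,28,38,43,30)`, dual ray
`b(n) = n·(85; 35,32,30,27,25,22,20)` = `T1Rays.bRay β1 n`, `d = 64n`) lists as its largest LETTERS item with no registry cell the
window `θ = p/n ∈ (36, 38]`: the by-name law M (`ClusterValuation.casLB b p ≤ v_p(Cas_j(b))`, THEOREM LB
`casoratianClassBound_holds`) is worth `e: 4 → 0` there (8.0 nats/step), but the kernel (`RayKernel.cell_cert`) needs the class bound
SCALE-FREE.  This file proves it, in the frame of `Cell1516.recordCell1516` (p3 g5) with the generic level classes of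
`LevelClass.classSet_level` (P1 g6) and the ray's point values `T1Rays.Ray1Points.pv_*` (gen-2 g16):
for `n ≥ 1`, a prime `36n < p ≤ 38n` and `x < p` the class of `x` is `{x, x+p, x+2p}` (`x + 2p ≤ 85n`, then `x < 13n`) or `{x, x+p}`, and

* `x < 20n`: `x` is a zero, the only possible pole is `x + p`, above the zero ⇒ at most one pole, TAME, `ν_x ≥ 0` (`Zlow`);
* `20n ≤ x < 27n`: two points with net exponents `(0 | ≥ −3)`, `(−1 | ≥ −2)`, `(−2 | ≥ −1)` ⇒ `E_x ≥ −3` (`Emid`);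
* `27n ≤ x < p`: the pole `x` sits at level `0` and `x + p > 63n` is not a pole ⇒ one pole, TAME, `ν_x ≥ 0` (`Thigh`);

hence `vbMin ≥ −3`, every row is `≥ 0`, **`casLB(b(n), p) ≥ −3`** (`casLB_ge38`; exact value `−3` at all 233 window primes with
`n ≤ 40`, `HOME/…/code/p1/g13/caslb.py`), and **`ray1WindowM38`: `v_p(Cas₇(b(n))) ≥ −3` for every `n ≥ 1` and prime `36n < p ≤ 38n`**
— the statement shape of `T1Rays.Ray1Window*`, consumed by typer's `RayC1KernelAtlasWin*` (`cell_cert`: on this window `vN = vN′ = 0`,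
`v_p(ρ) = 3`, so `k = min(9 − 3, 9 − 3) = 6 = e_base`).
-/

open Finset

namespace Summit.KontsevichZagierPeriods.Zeta5Search.Ray1M38

open Summit.KontsevichZagierPeriods.Zeta5Search.ClusterValuation
open Summit.KontsevichZagierPeriods.Zeta5Search.CasoratianValuation (InPolytope shift casoratian)
open Summit.KontsevichZagierPeriods.Zeta5Search.T1Rays
open Summit.KontsevichZagierPeriods.Zeta5Search.T1Rays.Ray1Points
open Summit.KontsevichZagierPeriods.Zeta5Search.LevelClass (classSet_level)
open Summit.KontsevichZagierPeriods.Zeta5Search.CellA (classExp_ge_sum classExp_le_classNu)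

variable {p : ℕ} [hp : Fact p.Prime]

/-! ### §1 The classes of the window (`85n < 3p`, `2p ≤ 85n`) -/

/-- Three-point classes: `x + 2p ≤ 85n < x + 3p` ⇒ the class of `x < p` is `{x, x+p, x+2p}`. -/
theorem classSet_three {n x : ℕ} (hx : x < p) (h2 : x + 2 * p ≤ 85 * n) (h3 : 85 * n < x + 2 * p + p) :
    classSet (bRay β1 n) p x = {x, x + p, x + 2 * p} := by
  have hL : x + 2 * p ≤ (bRay β1 n 0).toNat := by rw [b0_toNat]; exact h2
  have hL' : (bRay β1 n 0).toNat < x + 2 * p + p := by rw [b0_toNat]; exact h3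
  rw [classSet_level (bRay β1 n) hx hL hL']
  ext s
  simp only [mem_image, mem_range, mem_insert, mem_singleton]
  constructor
  · rintro ⟨k, hk, rfl⟩
    interval_cases k <;> simp
  · rintro (rfl | rfl | rfl)
    · exact ⟨0, by omega, by ring⟩
    · exact ⟨1, by omega, by ring⟩
    · exact ⟨2, by omega, by ring⟩

/-- Two-point classes: `x + p ≤ 85n < x + 2p` ⇒ the class of `x < p` is `{x, x+p}`. -/
theorem classSet_two {n x : ℕ} (hx : x < p) (h1 : x + p ≤ 85 * n) (h2 : 85 * n < x + p + p) :
    classSet (bRay β1 n) p x = {x, x + p} := by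
  have hL : x + 1 * p ≤ (bRay β1 n 0).toNat := by rw [b0_toNat]; omega
  have hL' : (bRay β1 n 0).toNat < x + 1 * p + p := by rw [b0_toNat]; omega
  rw [classSet_level (bRay β1 n) hx hL hL']
  ext s
  simp only [mem_image, mem_range, mem_insert, mem_singleton]
  constructor
  · rintro ⟨k, hk, rfl⟩
    interval_cases k <;> simp
  · rintro (rfl | rfl)
    · exact ⟨0, by omega, by ring⟩
    · exact ⟨1, by omega, by ring⟩

/-- In the well `[35n, 50n]` every point is a pole (order `6`, or `5` at the even centre). -/
theorem neg_well {n q : ℕ} (h1 : 35 * n ≤ q) (h2 : q ≤ 50 * n) : netExp (bRay β1 n) q < 0 := by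
  by_cases hc : 2 * q = 85 * n
  · rw [pv_cen hc]; norm_num
  · rw [pv_well h1 h2 hc]; norm_num

/-! ### §2 Class data by region (`35n < p ≤ 38n`, `x < p`; the lemmas `Zlow`/`Thigh` serve the window `(35n, 36n]` of `Ray1M36` too) -/

section Regions

variable {n x : ℕ} (h35 : 35 * n < p) (h38 : p ≤ 38 * n) (hx : x < p)

include h35 h38 hx in
/-- **Region `x < 20n`**: `x` is a zero and `x + 2p > 65n` (if present) is a zero, so the class has at most one pole (`x + p`),
lying above the zero `x`: if it has a pole it is a TAME single-pole class with `ν_x ≥ 0`. -/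
theorem Zlow (hx20 : x < 20 * n) :
    classPoleCount (bRay β1 n) p x ≤ 1 ∧ (1 ≤ classPoleCount (bRay β1 n) p x → 0 ≤ classNu (bRay β1 n) p x) := by
  have ex : netExp (bRay β1 n) x = 1 := pv_low hx20
  by_cases h3 : x + 2 * p ≤ 85 * n
  · -- three points
    have hcs := classSet_three hx h3 (by omega)
    have ex2 : netExp (bRay β1 n) (x + 2 * p) = 1 := pv_high (by omega)
    by_cases hpole : netExp (bRay β1 n) (x + p) < 0
    · have hcount : classPoleCount (bRay β1 n) p x = 1 := by
        unfold classPoleCount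
        rw [hcs, filter_insert, if_neg (by omega), filter_insert, if_pos hpole, filter_singleton, if_neg (by omega)]
        simp
      have htm : tameSingle (bRay β1 n) p x = true := by
        rw [tameSingle_iff]
        refine ⟨x + p, by rw [hcs]; simp, hpole, Or.inr fun s hs hlt => ?_⟩
        rw [hcs] at hs
        simp only [mem_insert, mem_singleton] at hs
        rcases hs with rfl | rfl | rfl
        · rw [ex]; norm_num
        · omega
        · omega
      refine ⟨by omega, fun _ => ?_⟩
      unfold classNu
      rw [if_pos ⟨hcount, htm⟩]
      exact le_max_right _ _
    · have hcount : classPoleCount (bRay β1 n) p x = 0 := by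
        unfold classPoleCount
        rw [hcs, filter_insert, if_neg (by omega), filter_insert, if_neg hpole, filter_singleton, if_neg (by omega)]
        simp
      exact ⟨by omega, fun h => by omega⟩
  · -- two points
    have hcs := classSet_two (n := n) hx (by omega) (by omega)
    by_cases hpole : netExp (bRay β1 n) (x + p) < 0
    · have hcount : classPoleCount (bRay β1 n) p x = 1 := by
        unfold classPoleCount
        rw [hcs, filter_insert, if_neg (by omega), filter_singleton, if_pos hpole]
        simp
      have htm : tameSingle (bRay β1 n) p x = true := by
        rw [tameSingle_iff]
        refine ⟨x + p, by rw [hcs]; simp, hpole, Or.inr fun s hs hlt => ?_⟩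
        rw [hcs] at hs
        simp only [mem_insert, mem_singleton] at hs
        rcases hs with rfl | rfl
        · rw [ex]; norm_num
        · omega
      refine ⟨by omega, fun _ => ?_⟩
      unfold classNu
      rw [if_pos ⟨hcount, htm⟩]
      exact le_max_right _ _
    · have hcount : classPoleCount (bRay β1 n) p x = 0 := by
        unfold classPoleCount
        rw [hcs, filter_insert, if_neg (by omega), filter_singleton, if_neg hpole]
        simp
      exact ⟨by omega, fun h => by omega⟩

include h35 h38 hx in
/-- **Region `20n ≤ x < 27n` on the window `36n < p`**: two points `x`, `x + p ∈ (56n, 65n)`; on `[20n,22n)`, `[22n,25n)`,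
`[25n,27n)` the net exponents are `0, −1, −2` at `x` and at least `−3, −2, −1` at `x + p`, so `E_x ≥ −3`.  (On `35n < p ≤ 36n` the
middle strip drops to `−4`: see `Ray1M36`.) -/
theorem Emid (h36 : 36 * n < p) (hx20 : 20 * n ≤ x) (hx27 : x < 27 * n) : -3 ≤ classExp (bRay β1 n) p x := by
  have hcs := classSet_two (n := n) hx (by omega) (by omega)
  refine le_trans ?_ (classExp_ge_sum _ _ _)
  rw [hcs, sum_pair (by omega)]
  by_cases hx22 : x < 22 * n
  · have ex : netExp (bRay β1 n) x = 0 := pv_lo1 hx20 hx22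
    have ep : -3 ≤ netExp (bRay β1 n) (x + p) := by
      by_cases h58 : x + p ≤ 58 * n
      · rw [pv_up4 (by omega) h58]
      · rw [pv_up3 (by omega) (by omega)]; norm_num
    omega
  push Not at hx22
  by_cases hx25 : x < 25 * n
  · have ex : netExp (bRay β1 n) x = -1 := pv_lo2 hx22 hx25
    have ep : -2 ≤ netExp (bRay β1 n) (x + p) := by
      by_cases h60 : x + p ≤ 60 * n
      · rw [pv_up3 (by omega) h60]
      · rw [pv_up2 (by omega) (by omega)]; norm_num
    omega
  push Not at hx25
  have ex : netExp (bRay β1 n) x = -2 := pv_lo3 hx25 hx27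
  have ep : -1 ≤ netExp (bRay β1 n) (x + p) := by
    by_cases h63 : x + p ≤ 63 * n
    · rw [pv_up2 (by omega) h63]
    · rw [pv_up1 (by omega) (by omega)]; norm_num
  omega

include h35 h38 hx in
/-- **Region `27n ≤ x < p` with `x + p > 63n`**: the pole `x` (net exponent `−3,…,−6`) is at level `0` and `x + p` is not a pole:
one pole, TAME, `ν_x ≥ 0`. -/
theorem Thigh (hx27 : 27 * n ≤ x) (h63 : 63 * n < x + p) :
    classPoleCount (bRay β1 n) p x = 1 ∧ 0 ≤ classNu (bRay β1 n) p x := by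
  have hcs := classSet_two (n := n) hx (by omega) (by omega)
  have ex : netExp (bRay β1 n) x < 0 := by
    by_cases h30 : x < 30 * n
    · rw [pv_lo4 hx27 h30]; norm_num
    by_cases h32 : x < 32 * n
    · rw [pv_lo5 (by omega) h32]; norm_num
    by_cases hx35 : x < 35 * n
    · rw [pv_lo6 (by omega) hx35]; norm_num
    · exact neg_well (by omega) (by omega)
  have ep : 0 ≤ netExp (bRay β1 n) (x + p) := by
    by_cases h65 : x + p ≤ 65 * n
    · rw [pv_up1 (by omega) h65]
    · rw [pv_high (by omega)]; norm_num
  have hcount : classPoleCount (bRay β1 n) p x = 1 := by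
    unfold classPoleCount
    rw [hcs, filter_insert, if_pos ex, filter_singleton, if_neg (by omega)]
    simp
  have htm : tameSingle (bRay β1 n) p x = true := by
    rw [tameSingle_iff]
    exact ⟨x, by rw [hcs]; simp, ex, Or.inl hx⟩
  refine ⟨hcount, ?_⟩
  unfold classNu
  rw [if_pos ⟨hcount, htm⟩]
  exact le_max_right _ _

include h35 h38 hx in
/-- Every pole class has `ν_x ≥ −3` (window `36n < p`). -/
theorem classNu_ge38 (h36 : 36 * n < p) (h1 : 1 ≤ classPoleCount (bRay β1 n) p x) : -3 ≤ classNu (bRay β1 n) p x := by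
  by_cases hx20 : x < 20 * n
  · exact le_trans (by norm_num) ((Zlow h35 h38 hx hx20).2 h1)
  by_cases hx27 : x < 27 * n
  · exact le_trans (Emid h35 h38 hx h36 (by omega) hx27) (classExp_le_classNu _ _ _)
  · exact le_trans (by norm_num) (Thigh h35 h38 hx (by omega) (by omega)).2

include h35 h38 hx in
/-- Every multipole class has `E_x ≥ −3` (window `36n < p`; they all lie in `20n ≤ x < 27n`). -/
theorem classExp_ge38 (h36 : 36 * n < p) (h2 : 2 ≤ classPoleCount (bRay β1 n) p x) : -3 ≤ classExp (bRay β1 n) p x := by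
  by_cases hx20 : x < 20 * n
  · have := (Zlow h35 h38 hx hx20).1; omega
  by_cases hx27 : x < 27 * n
  · exact Emid h35 h38 hx h36 (by omega) hx27
  · have := (Thigh h35 h38 hx (by omega) (by omega)).1; omega

end Regions

/-! ### §3 The class bound and the window -/

/-- **`casLB(b(n), p) ≥ −3`** for `n ≥ 1`, `36n < p ≤ 38n`. -/
theorem casLB_ge38 {n : ℕ} (h36 : 36 * n < p) (h38 : p ≤ 38 * n) : -3 ≤ casLB (bRay β1 n) p := by
  have h35 : 35 * n < p := by omega
  rcases casLB_ge_or_noPole (bRay β1 n) p (-3) 0 (fun x hx h1 => classNu_ge38 h35 h38 hx h36 h1) (by norm_num)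
      (fun x hx h2 => by linarith [classExp_ge38 h35 h38 hx h36 h2]) (fun _ => le_rfl) with ⟨h0, -⟩ | h
  · rw [h0]; norm_num
  · linarith

omit hp in
/-- **RAY-C1 WINDOW `θ ∈ (36, 38]`, law M by name**: `v_p(Cas₇(b(n))) ≥ −3` for every `n ≥ 1` and prime `36n < p ≤ 38n`
(THEOREM LB `casoratianClassBound_holds` at `casLB ≥ −3`; statement shape of `T1Rays.Ray1Window*`). -/
theorem ray1WindowM38 (n p : ℕ) (hn : 1 ≤ n) (hpr : p.Prime) (h36 : 36 * n < p) (h38 : p ≤ 38 * n)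
    (hne : casoratian (bRay β1 n) 7 ≠ 0) : (-3 : ℤ) ≤ padicValRat p (casoratian (bRay β1 n) 7) := by
  haveI : Fact p.Prime := ⟨hpr⟩
  have h5 : 5 ≤ p := by omega
  have hwin : (bRay β1 n 0 + 2 : ℤ) < (p : ℤ) ^ 2 := by
    rw [ray1_zero]
    have hp37 : (37 : ℤ) ≤ p := by exact_mod_cast (show 37 ≤ p by omega)
    have hpn : 36 * (n : ℤ) < p := by exact_mod_cast h36
    push_cast
    nlinarith
  exact (casLB_ge38 h36 h38).trans (casoratianClassBound_holds (bRay β1 n) 7 p (inPolytope_ray1 n) (by norm_num)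
    (by norm_num) (inPolytope_shift_ray1 hn) hpr h5 hwin hne)

end Summit.KontsevichZagierPeriods.Zeta5Search.Ray1M38
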